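import Summits.QuantumFields.YangMills.Theorems.SoloBlindTwoPointSequence
import Summits.QuantumFields.YangMills.Theorems.SoloBlindWilsonLoopRP
import HarnessLib

/-!
# Odd-time correlations of a covariant positive-time observable family
(solo-QuantumFields-blind, rung D7⁺, part 5)

Abstract form of parts 3–4 for ANY family of real observables `A_x` (`x` a site of the even torus)
that is translation covariant (`A_x(τ_v U) = A_{x−v}(U)`), reflection covariant
(`A_x(ΘU) = A_{θx}(U)`), positive-time when based in the positive half, measurable and uniformly
bounded — e.g. centred spatial plaquettes `φ_{x;ij} − c` and centred spatial Wilson loops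
`W^{R×T}_{x;ij} − c` of any size (`i, j ≠ 0`).  For the time-axis two-point function
`T_A(t) = ⟨A_0 · A_{t e₀}⟩_{Λ,β}` (`β ≥ 0`, any compact `G`):

* `T_A(−t) = T_A(t)`;  `⟨A_{θy} A_{y + s e₀}⟩ = T_A(2y₀ − 1 + s)`;
* `0 ≤ T_A(2k+1)` (`k + 1 ≤ L/2`);  `T_A(2k+3)² ≤ T_A(2k+1) T_A(2k+5)` (`k + 3 ≤ L/2`);
* `T_A(2k+1) ≤ T_A(2j+1)` for `2j+1 ≤ 2k+1 ≤ L/2` (`covariantFamily_oddTwoPoint_antitone`),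

and the Wilson-loop instance `wilsonLoop_oddTwoPoint_antitone`: the connected correlation of two
parallel spatial `R × T` loops is non-negative, log-convex and non-increasing in the odd time
separation up to half the torus.  [folklore consequences of OS positivity; typed statements this unit's]
-/

open MeasureTheory
open Literature.MathematicalPhysics.QuantumFieldTheory Literature.RepresentationTheory.CompactGroups

noncomputable section

namespace Summit.QuantumFields.YangMills.Theorems.SoloBlind

section Family

variable {d L N : ℕ} [NeZero d] [NeZero L] {G : Type*} [Group G] [TopologicalSpace G]
  [IsTopologicalGroup G] [CompactSpace G] [MeasurableSpace G] [BorelSpace G]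
  (ρ : G →* Matrix (Fin N) (Fin N) ℂ)

/-- A translation- and reflection-covariant, positive-time, bounded measurable family of real
observables indexed by the sites of the torus. -/
structure IsCovariantPositiveTimeFamily (A : Site d L → GaugeConfig d L G → ℝ) : Prop where
  cov : ∀ (x v : Site d L) (U : GaugeConfig d L G), A x (torusConfigShift v U) = A (x - v) U
  refl : ∀ (x : Site d L) (U : GaugeConfig d L G), A x U.timeReflect = A x.timeReflect U
  posTime : ∀ x : Site d L, 1 ≤ (x 0).val → (x 0).val ≤ L / 2 → IsPositiveTimeObservable (A x)
  meas : ∀ x : Site d L, Measurable (A x)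
  bdd : ∃ C : ℝ, ∀ (x : Site d L) (U : GaugeConfig d L G), |A x U| ≤ C

variable {ρ}

/-- `T_A(−t) = T_A(t)`. -/
theorem covariantFamily_twoPoint_neg {A : Site d L → GaugeConfig d L G → ℝ}
    (hA : IsCovariantPositiveTimeFamily A) (β : ℝ) (t : ZMod L) :
    wilsonExpectation ρ β (fun U => A 0 U * A (Pi.single 0 (-t)) U) =
      wilsonExpectation ρ β (fun U => A 0 U * A (Pi.single 0 t) U) := by
  have key : (fun U : GaugeConfig d L G => A 0 U * A (Pi.single 0 (-t)) U) =
      (fun U => A 0 U * A (Pi.single 0 t) U) ∘ torusConfigShift (Pi.single 0 t : Site d L) := by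
    funext U
    simp only [Function.comp_apply, hA.cov, zero_sub, sub_self, Pi.single_neg]
    ring
  rw [key, wilsonExpectation_comp_torusConfigShift]

/-- `⟨A_{θy} A_{y + s e₀}⟩ = T_A(2y₀ − 1 + s)`. -/
theorem covariantFamily_twoPoint_eq {A : Site d L → GaugeConfig d L G → ℝ}
    (hA : IsCovariantPositiveTimeFamily A) (β : ℝ) (y : Site d L) (s : ZMod L) :
    wilsonExpectation ρ β (fun U => A y.timeReflect U * A (y + Pi.single 0 s) U) =
      wilsonExpectation ρ β (fun U => A 0 U * A (Pi.single 0 (2 * y 0 - 1 + s)) U) := by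
  have key : (fun U : GaugeConfig d L G => A y.timeReflect U * A (y + Pi.single 0 s) U) =
      (fun U => A 0 U * A (Pi.single 0 (2 * y 0 - 1 + s)) U) ∘ torusConfigShift (-y.timeReflect) := by
    funext U
    simp only [Function.comp_apply, hA.cov, sub_neg_eq_add, zero_add, single_add_timeReflect]
  rw [key, wilsonExpectation_comp_torusConfigShift]

/-- `0 ≤ ⟨A_{θy} A_y⟩ = T_A(2y₀ − 1)` for `y` in the positive half (`β ≥ 0`, `L` even). -/
theorem covariantFamily_twoPoint_nonneg (hL : Even L) (hρ : Continuous ρ) {β : ℝ} (hβ : 0 ≤ β)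
    {A : Site d L → GaugeConfig d L G → ℝ} (hA : IsCovariantPositiveTimeFamily A) (y : Site d L)
    (hy1 : 1 ≤ (y 0).val) (hy2 : (y 0).val ≤ L / 2) :
    0 ≤ wilsonExpectation ρ β (fun U => A 0 U * A (Pi.single 0 (2 * y 0 - 1)) U) := by
  obtain ⟨C, hC⟩ := hA.bdd
  have h := wilsonExpectation_centred_timeReflect_mul_nonneg ρ hL hρ hβ (hA.meas y) ⟨C, hC y⟩
    (hA.posTime y hy1 hy2) 0
  simp only [sub_zero, hA.refl] at h
  have h2 := covariantFamily_twoPoint_eq (ρ := ρ) hA β y 0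
  simp only [Pi.single_zero, add_zero] at h2
  rw [h2] at h
  exact h

/-- Log-convexity: `T_A(2y₀ − 1 + s)² ≤ T_A(2y₀ − 1) · T_A(2z₀ − 1)`, `z = y + s e₀`, both in the
positive half. -/
theorem covariantFamily_twoPoint_logConvex (hL : Even L) (hρ : Continuous ρ) {β : ℝ} (hβ : 0 ≤ β)
    {A : Site d L → GaugeConfig d L G → ℝ} (hA : IsCovariantPositiveTimeFamily A) (y : Site d L)
    (s : ZMod L) (hy1 : 1 ≤ (y 0).val) (hy2 : (y 0).val ≤ L / 2)
    (hz1 : 1 ≤ ((y + Pi.single 0 s : Site d L) 0).val)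
    (hz2 : ((y + Pi.single 0 s : Site d L) 0).val ≤ L / 2) :
    (wilsonExpectation ρ β (fun U => A 0 U * A (Pi.single 0 (2 * y 0 - 1 + s)) U)) ^ 2 ≤
      wilsonExpectation ρ β (fun U => A 0 U * A (Pi.single 0 (2 * y 0 - 1)) U) *
        wilsonExpectation ρ β (fun U =>
          A 0 U * A (Pi.single 0 (2 * (y + Pi.single 0 s : Site d L) 0 - 1)) U) := by
  obtain ⟨C, hC⟩ := hA.bdd
  set z : Site d L := y + Pi.single 0 s with hz
  -- symmetry of the mixed pairing
  have hsymm : wilsonExpectation ρ β (fun U => A y U.timeReflect * A z U) =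
      wilsonExpectation ρ β (fun U => A z U.timeReflect * A y U) := by
    simp only [hA.refl]
    rw [covariantFamily_twoPoint_eq (ρ := ρ) hA β y s]
    have hy' : y = z + Pi.single 0 (-s) := by
      rw [hz, add_assoc, ← Pi.single_add, add_neg_cancel, Pi.single_zero, add_zero]
    have h2 := covariantFamily_twoPoint_eq (ρ := ρ) hA β z (-s)
    rw [← hy'] at h2
    rw [h2]
    congr 2
    rw [hz, Pi.add_apply, Pi.single_eq_same]
    ring
  have h := wilsonExpectation_timeReflect_mul_sq_le ρ hL hρ hβ (hA.meas y) ⟨C, hC y⟩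
    (hA.posTime y hy1 hy2) (hA.meas z) ⟨C, hC z⟩ (hA.posTime z hz1 hz2) hsymm
  simp only [hA.refl] at h
  have e1 := covariantFamily_twoPoint_eq (ρ := ρ) hA β y s
  have e2 := covariantFamily_twoPoint_eq (ρ := ρ) hA β y 0
  have e3 := covariantFamily_twoPoint_eq (ρ := ρ) hA β z 0
  simp only [Pi.single_zero, add_zero] at e2 e3
  rw [e1, e2, e3] at h
  exact h

/-- Sequence form: `a_k = T_A(2k+1)` is non-negative (`k + 1 ≤ L/2`). -/
theorem covariantFamily_odd_nonneg (hL : Even L) (hρ : Continuous ρ) {β : ℝ} (hβ : 0 ≤ β)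
    {A : Site d L → GaugeConfig d L G → ℝ} (hA : IsCovariantPositiveTimeFamily A) {k : ℕ}
    (hk : k + 1 ≤ L / 2) :
    0 ≤ wilsonExpectation ρ β (fun U => A 0 U * A (Pi.single 0 ((2 * k + 1 : ℕ) : ZMod L)) U) := by
  set y : Site d L := Pi.single 0 ((k + 1 : ℕ) : ZMod L) with hy
  have hy0 : y 0 = ((k + 1 : ℕ) : ZMod L) := by simp [hy]
  have hval : (y 0).val = k + 1 := by rw [hy0]; exact ZMod.val_natCast_of_lt (by omega)
  have h := covariantFamily_twoPoint_nonneg hL hρ hβ hA y (by omega) (by omega)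
  have hidx : 2 * y 0 - 1 = ((2 * k + 1 : ℕ) : ZMod L) := by rw [hy0]; push_cast; ring
  rw [hidx] at h
  exact h

/-- Sequence form: `a_{k+1}² ≤ a_k a_{k+2}` (`k + 3 ≤ L/2`). -/
theorem covariantFamily_odd_mulConvex (hL : Even L) (hρ : Continuous ρ) {β : ℝ} (hβ : 0 ≤ β)
    {A : Site d L → GaugeConfig d L G → ℝ} (hA : IsCovariantPositiveTimeFamily A) {k : ℕ}
    (hk : k + 3 ≤ L / 2) :
    (wilsonExpectation ρ β (fun U => A 0 U * A (Pi.single 0 ((2 * (k + 1) + 1 : ℕ) : ZMod L)) U)) ^ 2 ≤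
      wilsonExpectation ρ β (fun U => A 0 U * A (Pi.single 0 ((2 * k + 1 : ℕ) : ZMod L)) U) *
        wilsonExpectation ρ β (fun U => A 0 U * A (Pi.single 0 ((2 * (k + 2) + 1 : ℕ) : ZMod L)) U) := by
  set y : Site d L := Pi.single 0 ((k + 1 : ℕ) : ZMod L) with hy
  have hy0 : y 0 = ((k + 1 : ℕ) : ZMod L) := by simp [hy]
  have hz0 : (y + Pi.single 0 (2 : ZMod L) : Site d L) 0 = ((k + 3 : ℕ) : ZMod L) := by
    rw [Pi.add_apply, hy0, Pi.single_eq_same]; push_cast; ring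
  have hvaly : (y 0).val = k + 1 := by rw [hy0]; exact ZMod.val_natCast_of_lt (by omega)
  have hvalz : ((y + Pi.single 0 (2 : ZMod L) : Site d L) 0).val = k + 3 := by
    rw [hz0]; exact ZMod.val_natCast_of_lt (by omega)
  have h := covariantFamily_twoPoint_logConvex hL hρ hβ hA y 2 (by omega) (by omega) (by omega) (by omega)
  have h1 : 2 * y 0 - 1 + 2 = ((2 * (k + 1) + 1 : ℕ) : ZMod L) := by rw [hy0]; push_cast; ring
  have h2 : 2 * y 0 - 1 = ((2 * k + 1 : ℕ) : ZMod L) := by rw [hy0]; push_cast; ring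
  have h3 : 2 * (y + Pi.single 0 (2 : ZMod L) : Site d L) 0 - 1 = ((2 * (k + 2) + 1 : ℕ) : ZMod L) := by
    rw [hz0]; push_cast; ring
  rw [h1, h2, h3] at h
  exact h

/-- Sequence form: the torus symmetry `a_{L/2−1−k} = a_k`. -/
theorem covariantFamily_odd_symm (hL : Even L) {β : ℝ} {A : Site d L → GaugeConfig d L G → ℝ}
    (hA : IsCovariantPositiveTimeFamily A) {k : ℕ} (hk : k ≤ L / 2 - 1) :
    wilsonExpectation ρ β (fun U =>
        A 0 U * A (Pi.single 0 ((2 * (L / 2 - 1 - k) + 1 : ℕ) : ZMod L)) U) =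
      wilsonExpectation ρ β (fun U => A 0 U * A (Pi.single 0 ((2 * k + 1 : ℕ) : ZMod L)) U) := by
  have hL0 : L ≠ 0 := NeZero.ne L
  obtain ⟨r, hr⟩ := hL
  have hsum : 2 * (L / 2 - 1 - k) + 1 + (2 * k + 1) = L := by omega
  have hneg : ((2 * (L / 2 - 1 - k) + 1 : ℕ) : ZMod L) = -((2 * k + 1 : ℕ) : ZMod L) := by
    rw [eq_neg_iff_add_eq_zero, ← Nat.cast_add, hsum, ZMod.natCast_self]
  rw [hneg, covariantFamily_twoPoint_neg hA]

/-- **Monotonicity for covariant positive-time families.** For `β ≥ 0`, `L` even and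
`2j+1 ≤ 2k+1 ≤ L/2`: `T_A(2k+1) ≤ T_A(2j+1)`. -/
theorem covariantFamily_oddTwoPoint_antitone (hL : Even L) (hρ : Continuous ρ) {β : ℝ} (hβ : 0 ≤ β)
    {A : Site d L → GaugeConfig d L G → ℝ} (hA : IsCovariantPositiveTimeFamily A) {j k : ℕ}
    (hjk : j ≤ k) (hk : 2 * k ≤ L / 2 - 1) :
    wilsonExpectation ρ β (fun U => A 0 U * A (Pi.single 0 ((2 * k + 1 : ℕ) : ZMod L)) U) ≤
      wilsonExpectation ρ β (fun U => A 0 U * A (Pi.single 0 ((2 * j + 1 : ℕ) : ZMod L)) U) := by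
  have hL2 : 2 ≤ L := by obtain ⟨r, hr⟩ := hL; have := NeZero.ne L; omega
  exact antitone_of_mulConvex_symm (K := L / 2 - 1)
    (a := fun k => wilsonExpectation ρ β (fun U => A 0 U * A (Pi.single 0 ((2 * k + 1 : ℕ) : ZMod L)) U))
    (fun k hk => covariantFamily_odd_nonneg hL hρ hβ hA (by omega))
    (fun k hk => covariantFamily_odd_mulConvex hL hρ hβ hA (by omega))
    (fun k hk => covariantFamily_odd_symm (ρ := ρ) hL hA hk) hjk hk

end Family

/-! ### Instance: centred spatial Wilson loops -/

section WilsonLoops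

variable {d L N : ℕ} [NeZero d] [NeZero L] {G : Type*} [Group G] [TopologicalSpace G]
  [IsTopologicalGroup G] [CompactSpace G] [MeasurableSpace G] [BorelSpace G]
  (ρ : G →* Matrix (Fin N) (Fin N) ℂ)

omit [NeZero L] in
/-- Centred spatial `R × T` Wilson loops form a covariant positive-time family. -/
theorem isCovariantPositiveTimeFamily_wilsonLoop (hρ : Continuous ρ) {i j : Fin d} (hi : i ≠ 0)
    (hj : j ≠ 0) (R T : ℕ) (c : ℝ) :
    IsCovariantPositiveTimeFamily (L := L) (fun x U => wilsonLoop (G := G) ρ x i j R T U - c) where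
  cov x v U := by simp only [wilsonLoop_torusConfigShift]
  refl x U := by simp only [wilsonLoop_timeReflect ρ x hi hj]
  posTime x hx1 hx2 := fun U V hUV => by
    simp only [isPositiveTimeObservable_wilsonLoop ρ x hi hj R T hx1 hx2 U V hUV]
  meas x := (StringTension.measurable_wilsonLoop ρ hρ x i j R T).sub_const c
  bdd := ⟨1 + |c|, fun x U => (abs_sub _ _).trans (by
    gcongr; exact abs_wilsonLoop_le_one ρ hρ x i j R T U)⟩

/-- **Glueball/torelon-correlator form.** For `β ≥ 0`, `L` even, a spatial orientation `i, j ≠ 0`,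
loop size `R × T`, any constant `c` and `2j'+1 ≤ 2k+1 ≤ L/2`:
`⟨(W_0 − c)(W_{(2k+1)e₀} − c)⟩ ≤ ⟨(W_0 − c)(W_{(2j'+1)e₀} − c)⟩` — the connected correlation of
parallel spatial Wilson loops is non-increasing in the odd time separation up to half the torus. -/
theorem wilsonLoop_oddTwoPoint_antitone (hL : Even L) (hρ : Continuous ρ) {β : ℝ} (hβ : 0 ≤ β)
    {i j : Fin d} (hi : i ≠ 0) (hj : j ≠ 0) (R T : ℕ) (c : ℝ) {j' k : ℕ} (hjk : j' ≤ k)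
    (hk : 2 * k ≤ L / 2 - 1) :
    wilsonExpectation ρ β (fun U => (wilsonLoop ρ (0 : Site d L) i j R T U - c) *
        (wilsonLoop ρ (Pi.single 0 ((2 * k + 1 : ℕ) : ZMod L) : Site d L) i j R T U - c)) ≤
      wilsonExpectation ρ β (fun U => (wilsonLoop ρ (0 : Site d L) i j R T U - c) *
        (wilsonLoop ρ (Pi.single 0 ((2 * j' + 1 : ℕ) : ZMod L) : Site d L) i j R T U - c)) :=
  covariantFamily_oddTwoPoint_antitone hL hρ hβ
    (isCovariantPositiveTimeFamily_wilsonLoop (L := L) ρ hρ hi hj R T c) hjk hk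

end WilsonLoops

end Summit.QuantumFields.YangMills.Theorems.SoloBlind

end
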